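import Summits.BirchSwinnertonDyer.Rank1Residual.WAll.TargetCMTwoRamifiedTheta
import Summits.BirchSwinnertonDyer.Rank1Residual.WAll.TargetCMTwoRamifiedShuZhaiTwoFiftySix
import Literature.NumberTheory.EllipticCurves.IsogenyIdProofs
import HarnessLib
import HarnessLib.Audit.Tags

/-!
# Rung W-ALL of ladder BSD (D-0120) — the ramified slice of row 12₂: ISOGENY SATURATION of the booked
# congruent-number families, BY NAME — the residual of crux stmt-BirchSwinnertonDyer-20509 re-cut as
# «`ℚ`-isogeny classes containing NO booked `E_n` and NO Shu–Zhai twist of `256c1`» (cell `bsd-print-cf2`,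
# D-0131 (2) PRINT TIER, seat p1 = lead of crux `RamifiedOffTYZOfFacts` of route `PrintCf2`)

HONEST FRAMING (cell `bsd-print-cf2`, run/shared/lean/pub/bsd-print-cf2/; partition leaf «CornerF @ `p = 2`» =
`Summit.BirchSwinnertonDyer.WAllCornerFTwo`, OPEN AS A CLASS): STATEMENTS AND BOOKKEEPING ONLY — nothing asserted,
nothing booked, no named fact introduced, no published theorem restated; every glue theorem is excluded middle on
membership. The five congruent-number family predicates booked so far on the ramified slice —
`CongruentTYZProvedFamily` (item 20508, flag-free, closed INSIDE `𝔅_ram`), `CongruentTYZAtlasFJFamily` (stub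
`stub_offTYZ_atlasFJLeaf`, p541735, inside `𝔅_ram`), `CongruentMonskySMinusFamily` (stub `stub_offTYZ_sMinusLeaf`,
p546023, inside `𝔅_ram`), `CongruentTYZUPlusFamily` (aside 20471, LITERAL `tyz_genusPointData`) and
`CongruentThetaFamily` (aside 21185, LITERAL `tyz_cmPointGaloisData` + TYZ Thm 1.1) — all read membership UP TO
`ℚ`-ISOMORPHISM (`∃ C, C • congruentNumberCurve n = W`). But `BSD(E,2)` is constant on `ℚ`-ISOGENY classes of
globally minimal curves of analytic rank `≤ 1`, granted Cassels' invariance of the BSD quotient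
(`WeierstrassCurve.bsdRHS_eq_of_isIsogenous`, conjunct 3 of `𝔅_ram`), GZK (conjunct 1: `Ш` finite) and modularity
(conjunct 2: `L^{(r)}(E,1)/r! ≠ 0`) — tree theorem `Wuthrich2014.bsdp_of_isIsogenous`; seat p4 proved the instance
`PrintCf2.bsdp_two_of_isIsogenous_tyzProved` (p545974) for the proved families, and every `E_n` carries THREE
further globally minimal curves in its `ℚ`-isogeny class: the `j = 1728` partner `y² = x³ + 4n²x` (`n` odd; for
`n = 2m`: `y² = x³ + m²x`) and the two `j = 287496` curves `32a3^{(±n)}` (`PrintCf2RamifiedCongruentPartner`,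
p542724). The residual of record of crux 20509 (six-way `WAllCornerFTwoRamifiedOffTYZOffSMinusOffTheta`, p548609;
seat p2's parallel Shu–Zhai cut `WAllCornerFTwoRamifiedOffTYZOffSMinusOffShuZhai`, p551803, is already stated on
ISOGENY classes) still carries all of them. This file NAMES the isogeny closure and carves it out:

* §1 `CongruentBookedFamily` (the disjunction of the five booked family predicates) and
  `CongruentBookedIsogenyClass W` («`W` is `ℚ`-isogenous to a globally minimal member of a booked family»);
* §2 the leaf `WAllCornerFTwoRamifiedBookedIsogeny` and the residual `WAllCornerFTwoRamifiedOffBookedIsogeny`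
  («CM, `r_an = 1`, `2 ∣ d_K`, `W` isogenous to NO booked `E_n` and to NO Shu–Zhai twist of `256c1` ⇒
  `BSD(E,2)`» — TWO negated binders replace seven);
* §3 membership facts: a model member is an isogeny member (`W₀ := W`), an isogeny member has CM with `2`
  ramified (CM type is an isogeny invariant, `X12.cmRamified_iff_of_isIsogenous`);
* §4 glue, all EXACT: the six-way residual of p548609 ⟺ (its Shu–Zhai part) ∧ (its booked-isogeny part) ∧ the new
  residual; the same for p551803's six-way; the THREE-leaf composition
  `wAllCornerFTwoRamifiedOffTYZProved_of_bookedIsogeny_of_shuZhai_of_off` (booked-isogeny leaf, Shu–Zhai leaf,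
  isogeny-class residual ⟹ crux 20509's conclusion) for the lead's skeleton v4 of crux 20509; the exact three-way cut
  `wAllCornerFTwoRamified_iff_bookedIsogeny_shuZhai_off` of the ramified slice; restrictions from row 12₂.
The CLOSER of the new leaf RELATIVE to the five model leaves (`… → WAllCornerFTwoRamifiedBookedIsogeny`, granted
Cassels + GZK + modularity) is NOT logic and lands in
`Summits/BirchSwinnertonDyer/BirchSwinnertonDyer/Theorems/PrintCf2RamifiedOffTYZBookedIsogeny.lean` (seat p1); its
currency is, class by class, that of the model leaf (flag-free for TYZProved / AtlasFJ, LITERAL for U⁺ / 𝒮⁻ / theta).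

WHY (seat p1 = lead of crux 20509): after this cut the named residual of the ramified type is the honest object —
ISOGENY CLASSES with `j ∈ {1728, 287496}` containing no booked congruent-number curve and no Shu–Zhai twist, and
all of `j = 8000` — so that no curve whose `BSD(·,2)` follows from the tree by Cassels transport is counted as open.
beyond-print theorem: NO (Cassels 1965 / Milne ADT I.7.3; assembly).

References: `WAll/TargetCMTwoRamifiedFamilies.lean` (p533515), `…OffTYZProved.lean` (p536500), `…SMinus.lean`
(p544597), `…Theta.lean` (p548609), `…ShuZhaiTwoFiftySix.lean` (p551803), `X12/CMIsogenyInvariance.lean`;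
`Theorems/PrintCf2RamifiedTYZIsogenySaturation.lean` (p545974), `Theorems/PrintCf2RamifiedCongruentPartner.lean`
(p542724). [cite: MilneADT2006, Thm. I.7.3] [cite: Miller2011LMS, §1 and Def. 1.1]
[cite: SilvermanAdvancedTopics1994, Exercise 2.12(b) and App. A §3 (p. 483)] [cite: CremonaAlgorithms1997, §3.8
and Table 1 (class 32a)].
-/

noncomputable section

open scoped Classical

open WeierstrassCurve Literature.NumberTheory.EllipticCurves
  Literature.NumberTheory.EllipticCurves.Rank1Residual
open Summit.BirchSwinnertonDyer.Rank1Residual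

set_option autoImplicit false

namespace Summit.BirchSwinnertonDyer

/-! ### §1. Membership predicates: the booked congruent-number families and their `ℚ`-isogeny closure -/

/-- **The five congruent-number families booked on the ramified slice** (one disjunction): the proved TYZ families
(item 20508), the U⁺-road families (aside 20471), the `ω = 3` FJ atlas (stub p541735), Monsky's `𝒮⁻` (stub p546023)
and the theta-descent families (aside 21185). A class predicate; nothing asserted. [folklore] -/
def CongruentBookedFamily : P2.ClassAtTwo := fun W _ _ =>
  CongruentTYZProvedFamily W ∨ CongruentTYZUPlusFamily W ∨ CongruentTYZAtlasFJFamily W ∨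
    CongruentMonskySMinusFamily W ∨ CongruentThetaFamily W

/-- **`W` lies in the `ℚ`-ISOGENY CLASS of a booked congruent-number curve**: there is a globally minimal elliptic
`W₀` in `CongruentBookedFamily` with `W ∼_ℚ W₀`. Contains every model member (`W₀ := W`), and for every booked `E_n`
its `j = 1728` partner `y² = x³ + 4n²x` / `y² = x³ + (n/2)²x` and both `j = 287496` partners `32a3^{(±n)}`.
A definition with a body (data `W₀`), not a named fact; nothing asserted.
[cite: CremonaAlgorithms1997, §3.8 and Table 1 (class 32a)] -/
def CongruentBookedIsogenyClass (W : WeierstrassCurve ℚ) : Prop :=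
  ∃ (W₀ : WeierstrassCurve ℚ) (_ : W₀.IsElliptic) (_ : W₀.IsGloballyMinimal),
    IsIsogenous W W₀ ∧ CongruentBookedFamily W₀

/-! ### §2. Leaves: the booked-isogeny slice and the residual off it (and off the Shu–Zhai classes) -/

/-- **Ramified slice ON THE `ℚ`-ISOGENY CLASSES OF THE BOOKED CONGRUENT-NUMBER FAMILIES** (closed RELATIVE to the
five model leaves granted Cassels + GZK + modularity by `PrintCf2.wAllCornerFTwoRamifiedBookedIsogeny_of_leaves`,
Theorems side): CM, `ord_{s=1} L(E,s) = 1`, `2 ∣ d_K`, `W` isogenous to a booked member ⇒ `BSD(E,2)`. [folklore] -/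
@[conjecture] def WAllCornerFTwoRamifiedBookedIsogeny : Prop :=
  ∀ (W : WeierstrassCurve ℚ) [W.IsElliptic] [W.IsGloballyMinimal],
    W.HasCM → W.analyticRank = 1 → CMRamified W 2 → CongruentBookedIsogenyClass W → BSDp W 2

/-- **THE RESIDUAL OF CRUX 20509 IN ISOGENY-CLASS CURRENCY (OPEN)**: CM, `ord_{s=1} L(E,s) = 1`, `2 ∣ d_K`
(`K ∈ {ℚ(i), ℚ(√−2)}`), and `W` is `ℚ`-isogenous to NO globally minimal member of the five booked congruent-number
families and to NO Shu–Zhai twist `256c1^{(−pM)}` ⇒ `BSD(E,2)`. Contains: the isogeny classes of the `E_m` of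
analytic rank one with `s(m) ≥ 3`, or `s(m) = 1` and even genus sums off every booked shape (each class = `E_m`,
its `j = 1728` partner `A = 4m²` resp. `(m/2)²`, and `32a3^{(±m)}`); the isogeny classes of the quartic twists
`y² = x³ + Ax` containing no `E_m` at all (`A ∉ {−m², 4m², (m/2)²}`, e.g. `±A ∉ ℤ²`) off the Shu–Zhai classes
`{2p²M², −8p²M²}`; all of `j = 8000`. No theorem in print. [folklore] -/
@[conjecture] def WAllCornerFTwoRamifiedOffBookedIsogeny : Prop :=
  ∀ (W : WeierstrassCurve ℚ) [W.IsElliptic] [W.IsGloballyMinimal],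
    W.HasCM → W.analyticRank = 1 → CMRamified W 2 →
      ¬ CongruentBookedIsogenyClass W → ¬ P2.IsIsogenousToShuZhaiTwoFiftySixTwist W → BSDp W 2

/-! ### §3. Membership facts -/

/-- A model member of a booked family is an isogeny member (`W₀ := W`, the identity isogeny). [folklore] -/
theorem congruentBookedIsogenyClass_of_congruentBookedFamily {W : WeierstrassCurve ℚ} [W.IsElliptic]
    [W.IsGloballyMinimal] (h : CongruentBookedFamily W) : CongruentBookedIsogenyClass W :=
  ⟨W, ‹_›, ‹_›, isIsogenous_self W, h⟩

/-- Members of the proved TYZ families are isogeny members. [folklore] -/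
theorem congruentBookedIsogenyClass_of_congruentTYZProvedFamily {W : WeierstrassCurve ℚ} [W.IsElliptic]
    [W.IsGloballyMinimal] (h : CongruentTYZProvedFamily W) : CongruentBookedIsogenyClass W :=
  congruentBookedIsogenyClass_of_congruentBookedFamily (Or.inl h)

/-- Members of the U⁺-road families are isogeny members. [folklore] -/
theorem congruentBookedIsogenyClass_of_congruentTYZUPlusFamily {W : WeierstrassCurve ℚ} [W.IsElliptic]
    [W.IsGloballyMinimal] (h : CongruentTYZUPlusFamily W) : CongruentBookedIsogenyClass W :=
  congruentBookedIsogenyClass_of_congruentBookedFamily (Or.inr (Or.inl h))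

/-- Members of the FJ atlas are isogeny members. [folklore] -/
theorem congruentBookedIsogenyClass_of_congruentTYZAtlasFJFamily {W : WeierstrassCurve ℚ} [W.IsElliptic]
    [W.IsGloballyMinimal] (h : CongruentTYZAtlasFJFamily W) : CongruentBookedIsogenyClass W :=
  congruentBookedIsogenyClass_of_congruentBookedFamily (Or.inr (Or.inr (Or.inl h)))

/-- Members of Monsky's `𝒮⁻` are isogeny members. [folklore] -/
theorem congruentBookedIsogenyClass_of_congruentMonskySMinusFamily {W : WeierstrassCurve ℚ} [W.IsElliptic]
    [W.IsGloballyMinimal] (h : CongruentMonskySMinusFamily W) : CongruentBookedIsogenyClass W :=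
  congruentBookedIsogenyClass_of_congruentBookedFamily (Or.inr (Or.inr (Or.inr (Or.inl h))))

/-- Members of the theta-descent families are isogeny members. [folklore] -/
theorem congruentBookedIsogenyClass_of_congruentThetaFamily {W : WeierstrassCurve ℚ} [W.IsElliptic]
    [W.IsGloballyMinimal] (h : CongruentThetaFamily W) : CongruentBookedIsogenyClass W :=
  congruentBookedIsogenyClass_of_congruentBookedFamily (Or.inr (Or.inr (Or.inr (Or.inr h))))

/-- Every member of a booked family has CM by `ℤ[i]` with `2` ramified (`j = 1728`). [folklore] -/
theorem hasCM_and_cmRamified_two_of_congruentBookedFamily {W : WeierstrassCurve ℚ} [W.IsElliptic]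
    [W.IsGloballyMinimal] (h : CongruentBookedFamily W) : W.HasCM ∧ CMRamified W 2 := by
  rcases h with h | h | h | h | h
  · exact hasCM_and_cmRamified_two_of_congruentTYZProvedFamily h
  · exact hasCM_and_cmRamified_two_of_congruentTYZUPlusFamily h
  · exact hasCM_and_cmRamified_two_of_congruentTYZAtlasFJFamily h
  · exact hasCM_and_cmRamified_two_of_congruentMonskySMinusFamily h
  · exact hasCM_and_cmRamified_two_of_congruentThetaFamily h

/-- **The booked isogeny classes lie in the ramified slice**: CM and the CM type are `ℚ`-isogeny invariants
(`X12.hasCM_iff_of_isIsogenous`, `X12.cmRamified_iff_of_isIsogenous`).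
[cite: SilvermanAdvancedTopics1994, Exercise 2.12(b) and App. A §3 (p. 483)] -/
theorem hasCM_and_cmRamified_two_of_congruentBookedIsogenyClass {W : WeierstrassCurve ℚ} [W.IsElliptic]
    (h : CongruentBookedIsogenyClass W) : W.HasCM ∧ CMRamified W 2 := by
  obtain ⟨W₀, _, _, hiso, hF⟩ := h
  obtain ⟨hCM₀, hram₀⟩ := hasCM_and_cmRamified_two_of_congruentBookedFamily hF
  have hCM : W.HasCM := (X12.hasCM_iff_of_isIsogenous hiso).mpr hCM₀
  exact ⟨hCM, (X12.cmRamified_iff_of_isIsogenous hiso hCM 2).mpr hram₀⟩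

/-! ### §4. Glue (excluded middle on membership only; every cut exact) -/

/-- **The six-way residual of p548609 ⟺ (its Shu–Zhai part) ∧ (its booked-isogeny part) ∧ the isogeny-class
residual** (EXACT; the two parts spelled out with the six-way binders). [folklore] -/
theorem wAllCornerFTwoRamifiedOffTYZOffSMinusOffTheta_iff_onShuZhai_onBookedIsogeny_off :
    WAllCornerFTwoRamifiedOffTYZOffSMinusOffTheta ↔
      (∀ (W : WeierstrassCurve ℚ) [W.IsElliptic] [W.IsGloballyMinimal],
          W.HasCM → W.analyticRank = 1 → CMRamified W 2 → ¬ CongruentTYZProvedFamily W →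
            ¬ CongruentTYZUPlusFamily W → ¬ CongruentTYZAtlasFJFamily W → ¬ CongruentMonskySMinusFamily W →
            ¬ CongruentThetaFamily W → P2.IsIsogenousToShuZhaiTwoFiftySixTwist W → BSDp W 2) ∧
      (∀ (W : WeierstrassCurve ℚ) [W.IsElliptic] [W.IsGloballyMinimal],
          W.HasCM → W.analyticRank = 1 → CMRamified W 2 → ¬ CongruentTYZProvedFamily W →
            ¬ CongruentTYZUPlusFamily W → ¬ CongruentTYZAtlasFJFamily W → ¬ CongruentMonskySMinusFamily W →
            ¬ CongruentThetaFamily W → ¬ P2.IsIsogenousToShuZhaiTwoFiftySixTwist W →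
            CongruentBookedIsogenyClass W → BSDp W 2) ∧
      WAllCornerFTwoRamifiedOffBookedIsogeny := by
  constructor
  · intro h
    refine ⟨fun W _ _ hcm hr1 hram h1 h2 h3 h4 h5 _ ↦ h W hcm hr1 hram h1 h2 h3 h4 h5,
      fun W _ _ hcm hr1 hram h1 h2 h3 h4 h5 _ _ ↦ h W hcm hr1 hram h1 h2 h3 h4 h5,
      fun W _ _ hcm hr1 hram hI _ ↦ h W hcm hr1 hram ?_ ?_ ?_ ?_ ?_⟩
    · exact fun hm ↦ hI (congruentBookedIsogenyClass_of_congruentTYZProvedFamily hm)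
    · exact fun hm ↦ hI (congruentBookedIsogenyClass_of_congruentTYZUPlusFamily hm)
    · exact fun hm ↦ hI (congruentBookedIsogenyClass_of_congruentTYZAtlasFJFamily hm)
    · exact fun hm ↦ hI (congruentBookedIsogenyClass_of_congruentMonskySMinusFamily hm)
    · exact fun hm ↦ hI (congruentBookedIsogenyClass_of_congruentThetaFamily hm)
  · rintro ⟨hZ, hI, hO⟩ W _ _ hcm hr1 hram h1 h2 h3 h4 h5
    by_cases h6 : P2.IsIsogenousToShuZhaiTwoFiftySixTwist W
    · exact hZ W hcm hr1 hram h1 h2 h3 h4 h5 h6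
    · by_cases h7 : CongruentBookedIsogenyClass W
      · exact hI W hcm hr1 hram h1 h2 h3 h4 h5 h6 h7
      · exact hO W hcm hr1 hram h7 h6

/-- **The six-way residual of p548609 from the Shu–Zhai leaf, the booked-isogeny leaf and the isogeny-class
residual** (the reduction used by skeleton v4 of crux 20509). [folklore] -/
theorem wAllCornerFTwoRamifiedOffTYZOffSMinusOffTheta_of_shuZhai_of_bookedIsogeny_of_off
    (hZ : WAllCornerFTwoRamifiedShuZhaiTwoFiftySix) (hI : WAllCornerFTwoRamifiedBookedIsogeny)
    (hO : WAllCornerFTwoRamifiedOffBookedIsogeny) : WAllCornerFTwoRamifiedOffTYZOffSMinusOffTheta :=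
  wAllCornerFTwoRamifiedOffTYZOffSMinusOffTheta_iff_onShuZhai_onBookedIsogeny_off.2
    ⟨fun W _ _ hcm hr1 hram _ _ _ _ _ h6 ↦ hZ W hcm hr1 hram h6,
      fun W _ _ hcm hr1 hram _ _ _ _ _ _ h7 ↦ hI W hcm hr1 hram h7, hO⟩

/-- The isogeny-class residual is a restriction of the six-way residual of p548609. [folklore] -/
theorem wAllCornerFTwoRamifiedOffBookedIsogeny_of_offTYZOffSMinusOffTheta
    (h : WAllCornerFTwoRamifiedOffTYZOffSMinusOffTheta) : WAllCornerFTwoRamifiedOffBookedIsogeny :=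
  (wAllCornerFTwoRamifiedOffTYZOffSMinusOffTheta_iff_onShuZhai_onBookedIsogeny_off.1 h).2.2

/-- **Seat p2's six-way residual of p551803 (off the Shu–Zhai classes) ⟺ (its theta part) ∧ (its booked-isogeny
part) ∧ the isogeny-class residual** (EXACT). [folklore] -/
theorem wAllCornerFTwoRamifiedOffTYZOffSMinusOffShuZhai_iff_onTheta_onBookedIsogeny_off :
    WAllCornerFTwoRamifiedOffTYZOffSMinusOffShuZhai ↔
      (∀ (W : WeierstrassCurve ℚ) [W.IsElliptic] [W.IsGloballyMinimal],
          W.HasCM → W.analyticRank = 1 → CMRamified W 2 → ¬ CongruentTYZProvedFamily W →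
            ¬ CongruentTYZUPlusFamily W → ¬ CongruentTYZAtlasFJFamily W → ¬ CongruentMonskySMinusFamily W →
            ¬ P2.IsIsogenousToShuZhaiTwoFiftySixTwist W → CongruentThetaFamily W → BSDp W 2) ∧
      (∀ (W : WeierstrassCurve ℚ) [W.IsElliptic] [W.IsGloballyMinimal],
          W.HasCM → W.analyticRank = 1 → CMRamified W 2 → ¬ CongruentTYZProvedFamily W →
            ¬ CongruentTYZUPlusFamily W → ¬ CongruentTYZAtlasFJFamily W → ¬ CongruentMonskySMinusFamily W →
            ¬ P2.IsIsogenousToShuZhaiTwoFiftySixTwist W → ¬ CongruentThetaFamily W →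
            CongruentBookedIsogenyClass W → BSDp W 2) ∧
      WAllCornerFTwoRamifiedOffBookedIsogeny := by
  constructor
  · intro h
    refine ⟨fun W _ _ hcm hr1 hram h1 h2 h3 h4 h5 _ ↦ h W hcm hr1 hram h1 h2 h3 h4 h5,
      fun W _ _ hcm hr1 hram h1 h2 h3 h4 h5 _ _ ↦ h W hcm hr1 hram h1 h2 h3 h4 h5,
      fun W _ _ hcm hr1 hram hI hZ ↦ h W hcm hr1 hram ?_ ?_ ?_ ?_ hZ⟩
    · exact fun hm ↦ hI (congruentBookedIsogenyClass_of_congruentTYZProvedFamily hm)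
    · exact fun hm ↦ hI (congruentBookedIsogenyClass_of_congruentTYZUPlusFamily hm)
    · exact fun hm ↦ hI (congruentBookedIsogenyClass_of_congruentTYZAtlasFJFamily hm)
    · exact fun hm ↦ hI (congruentBookedIsogenyClass_of_congruentMonskySMinusFamily hm)
  · rintro ⟨hT, hI, hO⟩ W _ _ hcm hr1 hram h1 h2 h3 h4 h5
    by_cases h6 : CongruentThetaFamily W
    · exact hT W hcm hr1 hram h1 h2 h3 h4 h5 h6
    · by_cases h7 : CongruentBookedIsogenyClass W
      · exact hI W hcm hr1 hram h1 h2 h3 h4 h5 h6 h7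
      · exact hO W hcm hr1 hram h7 h5

/-- Seat p2's six-way residual from the theta leaf, the booked-isogeny leaf and the isogeny-class residual.
[folklore] -/
theorem wAllCornerFTwoRamifiedOffTYZOffSMinusOffShuZhai_of_theta_of_bookedIsogeny_of_off
    (hT : WAllCornerFTwoRamifiedTheta) (hI : WAllCornerFTwoRamifiedBookedIsogeny)
    (hO : WAllCornerFTwoRamifiedOffBookedIsogeny) : WAllCornerFTwoRamifiedOffTYZOffSMinusOffShuZhai :=
  wAllCornerFTwoRamifiedOffTYZOffSMinusOffShuZhai_iff_onTheta_onBookedIsogeny_off.2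
    ⟨fun W _ _ hcm hr1 hram _ _ _ _ _ h6 ↦ hT W hcm hr1 hram h6,
      fun W _ _ hcm hr1 hram _ _ _ _ _ _ h7 ↦ hI W hcm hr1 hram h7, hO⟩

/-- **The booked-isogeny leaf restricts to each of the five model leaves** (model members are isogeny members):
the proved-TYZ leaf … [folklore] -/
theorem wAllCornerFTwoRamifiedTYZProved_of_bookedIsogeny (h : WAllCornerFTwoRamifiedBookedIsogeny) :
    WAllCornerFTwoRamifiedTYZProved :=
  fun W _ _ hcm hr1 hram hm ↦ h W hcm hr1 hram (congruentBookedIsogenyClass_of_congruentTYZProvedFamily hm)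

/-- … the U⁺-road leaf … [folklore] -/
theorem wAllCornerFTwoRamifiedTYZUPlus_of_bookedIsogeny (h : WAllCornerFTwoRamifiedBookedIsogeny) :
    WAllCornerFTwoRamifiedTYZUPlus :=
  fun W _ _ hcm hr1 hram hm ↦ h W hcm hr1 hram (congruentBookedIsogenyClass_of_congruentTYZUPlusFamily hm)

/-- … the FJ-atlas leaf … [folklore] -/
theorem wAllCornerFTwoRamifiedTYZAtlasFJ_of_bookedIsogeny (h : WAllCornerFTwoRamifiedBookedIsogeny) :
    WAllCornerFTwoRamifiedTYZAtlasFJ :=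
  fun W _ _ hcm hr1 hram hm ↦ h W hcm hr1 hram (congruentBookedIsogenyClass_of_congruentTYZAtlasFJFamily hm)

/-- … the `𝒮⁻` leaf … [folklore] -/
theorem wAllCornerFTwoRamifiedSMinus_of_bookedIsogeny (h : WAllCornerFTwoRamifiedBookedIsogeny) :
    WAllCornerFTwoRamifiedSMinus :=
  fun W _ _ hcm hr1 hram hm ↦ h W hcm hr1 hram (congruentBookedIsogenyClass_of_congruentMonskySMinusFamily hm)

/-- … and the theta leaf. [folklore] -/
theorem wAllCornerFTwoRamifiedTheta_of_bookedIsogeny (h : WAllCornerFTwoRamifiedBookedIsogeny) :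
    WAllCornerFTwoRamifiedTheta :=
  fun W _ _ hcm hr1 hram hm ↦ h W hcm hr1 hram (congruentBookedIsogenyClass_of_congruentThetaFamily hm)

/-- **Crux 20509's conclusion from THREE leaves**: the booked-isogeny leaf (which absorbs the U⁺, FJ-atlas, `𝒮⁻`
and theta model leaves), the Shu–Zhai leaf and the isogeny-class residual give `WAllCornerFTwoRamifiedOffTYZProved`
— the composition of the lead's skeleton v4 of crux 20509 (excluded middle only). [folklore] -/
theorem wAllCornerFTwoRamifiedOffTYZProved_of_bookedIsogeny_of_shuZhai_of_off
    (hI : WAllCornerFTwoRamifiedBookedIsogeny) (hZ : WAllCornerFTwoRamifiedShuZhaiTwoFiftySix)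
    (hO : WAllCornerFTwoRamifiedOffBookedIsogeny) : WAllCornerFTwoRamifiedOffTYZProved :=
  wAllCornerFTwoRamifiedOffTYZProved_of_uPlus_of_atlasFJ_of_sMinus_of_theta_of_off
    (wAllCornerFTwoRamifiedTYZUPlus_of_bookedIsogeny hI) (wAllCornerFTwoRamifiedTYZAtlasFJ_of_bookedIsogeny hI)
    (wAllCornerFTwoRamifiedSMinus_of_bookedIsogeny hI) (wAllCornerFTwoRamifiedTheta_of_bookedIsogeny hI)
    (wAllCornerFTwoRamifiedOffTYZOffSMinusOffTheta_of_shuZhai_of_bookedIsogeny_of_off hZ hI hO)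

/-- **The ramified slice of row 12₂ ⟺ the booked-isogeny leaf ∧ the Shu–Zhai leaf ∧ the isogeny-class residual**
(EXACT: three slices instead of eight; the proved-TYZ leaf is the booked-isogeny leaf restricted). [folklore] -/
theorem wAllCornerFTwoRamified_iff_bookedIsogeny_shuZhai_off :
    WAllCornerFTwoRamified ↔
      WAllCornerFTwoRamifiedBookedIsogeny ∧ WAllCornerFTwoRamifiedShuZhaiTwoFiftySix ∧
        WAllCornerFTwoRamifiedOffBookedIsogeny := by
  constructor
  · intro h
    exact ⟨fun W _ _ hcm hr1 hram _ ↦ h W hcm hr1 hram, fun W _ _ hcm hr1 hram _ ↦ h W hcm hr1 hram,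
      fun W _ _ hcm hr1 hram _ _ ↦ h W hcm hr1 hram⟩
  · rintro ⟨hI, hZ, hO⟩
    exact wAllCornerFTwoRamified_of_tyzProved_of_offTYZProved (wAllCornerFTwoRamifiedTYZProved_of_bookedIsogeny hI)
      (wAllCornerFTwoRamifiedOffTYZProved_of_bookedIsogeny_of_shuZhai_of_off hI hZ hO)

/-- The booked-isogeny leaf is a restriction of the ramified slice … [folklore] -/
theorem wAllCornerFTwoRamifiedBookedIsogeny_of_wAllCornerFTwoRamified (h : WAllCornerFTwoRamified) :
    WAllCornerFTwoRamifiedBookedIsogeny :=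
  (wAllCornerFTwoRamified_iff_bookedIsogeny_shuZhai_off.1 h).1

/-- … and so is the isogeny-class residual. [folklore] -/
theorem wAllCornerFTwoRamifiedOffBookedIsogeny_of_wAllCornerFTwoRamified (h : WAllCornerFTwoRamified) :
    WAllCornerFTwoRamifiedOffBookedIsogeny :=
  (wAllCornerFTwoRamified_iff_bookedIsogeny_shuZhai_off.1 h).2.2

/-- Row 12₂ restricts to the booked-isogeny leaf … [folklore] -/
theorem wAllCornerFTwoRamifiedBookedIsogeny_of_wAllCornerFTwo (h : WAllCornerFTwo) :
    WAllCornerFTwoRamifiedBookedIsogeny :=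
  wAllCornerFTwoRamifiedBookedIsogeny_of_wAllCornerFTwoRamified (wAllCornerFTwo_iff_slices.1 h).2.2.1

/-- … and to the isogeny-class residual. [folklore] -/
theorem wAllCornerFTwoRamifiedOffBookedIsogeny_of_wAllCornerFTwo (h : WAllCornerFTwo) :
    WAllCornerFTwoRamifiedOffBookedIsogeny :=
  wAllCornerFTwoRamifiedOffBookedIsogeny_of_wAllCornerFTwoRamified (wAllCornerFTwo_iff_slices.1 h).2.2.1

/-- **Row 12₂ with the ramified slice in isogeny-class currency**: `WAllCornerFTwo` ⟺ split-good ∧ split-bad ∧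
(booked-isogeny ∧ Shu–Zhai `256c1` ∧ isogeny-class residual) ∧ inert-good ∧ inert-bad. [folklore] -/
theorem wAllCornerFTwo_iff_slices_bookedIsogeny_shuZhai_off :
    WAllCornerFTwo ↔ WAllCornerFTwoSplitGood ∧ WAllCornerFTwoSplitBad ∧
      (WAllCornerFTwoRamifiedBookedIsogeny ∧ WAllCornerFTwoRamifiedShuZhaiTwoFiftySix ∧
        WAllCornerFTwoRamifiedOffBookedIsogeny) ∧
      WAllCornerFTwoInertGood ∧ WAllCornerFTwoInertBad := by
  rw [wAllCornerFTwo_iff_slices, wAllCornerFTwoRamified_iff_bookedIsogeny_shuZhai_off]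

end Summit.BirchSwinnertonDyer

end
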